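import Summits.QuantumFields.BalabanUV.Beta.EriceFlowEnclosureB12AsPrintedPointwiseFadingZeroHistory

/-!
# Beta / EriceFlowEnclosureB12AsPrintedPointwiseFadingZeroHistoryConstants — WHAT (0.31) FORCES, part 14: THROUGH THE ZERO HISTORY.
# Part 13 (`…PointwiseFadingZeroHistory`) gave every family with node U2's coupling-chart moduli (`HistLipschitz Λ γ β` + `FadingMemory C θ Λ`, 0 ≤ θ < 1) ONE value
# `b⁰_k` of `β_{k+1}` at the zero history, with `|β_{k+1}(v) − b⁰_k| ≤ Cδ∕(1−θ)` on ]0, δ]^{k+1}.  THIS FILE (generic `β : HBeta`, kernel of part 14) turns the sequence `b⁰`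
# into THE currency of the lower ∕ positivity side:
#  §1 **BOX LETTERS ⟺ BOUNDS ON `b⁰`**: `BetaLowerH b δ β ⟹ b ≤ b⁰_k ∀k` (any box δ, `le_zeroHist_of_betaLowerH`) and `(∀k, b ≤ b⁰_k) ⟹ BetaLowerH (b − Cδ∕(1−θ)) δ β` on EVERY
#     `δ ≤ γ` (`betaLowerH_of_le_zeroHist`); upper twins; **`betaAFH_iff_exists_pos_floor`**: the cell's AF letter `FlowStep.BetaAFH β ⟺ ∃ b > 0, ∀k, b ≤ b⁰_k`; and the OPTIMAL box
#     constants: **`isLUB_boxFloors`** (the admissible box floors have supremum `⨅_k b⁰_k`), **`isGLB_boxCeilings`** (the admissible box ceilings have infimum `⨆_k b⁰_k`).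
#  §2 **RUN-WISE NECESSITY AT ONE SCALE** (moduli only, NO NE4): small histories carrying a lower (upper) bound up to a linear defect force it on `b⁰_k`
#     (`le_zeroHist_of_small_histories` ∕ `zeroHist_le_of_small_histories`), hence **`zeroHist_window_of_pinnedRuns`**: runs of (0.20) of depth k+1 pinned at endpoints `g → 0⁺`
#     inside ]0, γ] with the (0.31)-window `[B, B′]` (B ≥ 0) force `B ≤ b⁰_k ≤ B′` — (0.31)'s constants on the lattice `K = k+1` ARE bounds on the k-th intrinsic one-loop coefficient.
#  §3 **WITH NE4** (`ScaleShiftRate c θ γ β`, part 11's `b⋆` = `hb`): `b⁰` is bounded (`zeroHist_mem_Icc`: `|b⁰_k − b⋆| ≤ c∕(1−θ)`), eventually `≥ b⋆∕2` when `b⋆ > 0`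
#     (`eventually_half_bstar_le_zeroHist`), and **`exists_pos_floor_iff`**: `(∃ b > 0, ∀k, b ≤ b⁰_k) ⟺ (0 < b⋆ ∧ ∀k, 0 < b⁰_k)` — a positive floor is the limit's sign PLUS the sign
#     of EVERY early coefficient (THE INTRINSIC CAP LIST); `iInf_zeroHist_pos_iff`; and THE FACE: **`exists_zeroHist_eq_zero`** — `0 ≤ b⁰_k ∀k`, `0 < b⋆`, no positive floor ⟹ some `b⁰_k = 0`.
# The carrier ENDs (the uniform (0.31) encloses every `b⁰_k`; the typed (0.31) forces `0 ≤ b⁰_k`; off the face the two readings coincide) are part 14b `…ZeroHistoryConstantsEnd`.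
# (β-flow team, prover 2 = lower ∕ positivity side, unit `b2b-balaban-beta-bflow-p2`, gen 52; ROW AP-I × node U2's letters; kernel of part 14)

HONEST FRAMING (page 1 of everything the β sub-cell writes): discharging `BetaPertH` makes Bałaban's UV stability UNCONDITIONAL — a
real constructive-QFT result; it is NOT the continuum limit and NOT the Clay problem.  HONEST DEPENDENCY (cell reorg 2026-08-19,
verbatim): «continuum YM on T⁴ ⇐ BetaPertH ∧ nine spine estimates (0/9 proved); BetaPertH ⇐ (D1) ∧ (D4) ∧ CAP+tail; G-an2-4 gates
asym, D1 and NE2/3/4.»  THIS MODULE DISCHARGES NOTHING: [folklore] limit ∕ finite-sum bookkeeping for an ABSTRACT `β : FlowStep.HBeta` under node U2's HYPOTHESIS SHAPES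
`T4CouplingMatching.HistLipschitz ∕ FadingMemory ∕ ScaleShiftRate` (NONE printed — [Balaban1987RG1] p. 298 states the history dependence only, p. 264 defers «other properties»;
GAPS G-t4-U2-1 ∕ G-t4-U2-2), over part 13's `exists_small_const` ∕ `abs_sub_zeroHist_le_sum_moduli` ∕ `abs_sub_zeroHist_le_box` ∕ `abs_zeroHist_sub_bstar_le` ∕ `tendsto_zeroHist_bstar`
and part 6's `rowSum_le` BY NAME.  `b⁰` is a sequence with a DISPLAYED property (`hb0`), `b⋆` a real with `hb` — no definition.  The "CAP list" language is the cell's (socket e3 ∕ `Beta/Assembly`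
`LimitForm.thm2Printed_of_list`): here it only NAMES the finitely many early indices before `eventually_half_bstar_le_zeroHist`'s threshold; nothing of Bałaban's (1.22), its one-loop
coefficients, their sign, the moduli or the rate is asserted.

WHAT THIS FILE PROVES (0 sorry, 0 def):
§1 `le_zeroHist_of_betaLowerH`, `zeroHist_le_of_betaUpperH`, **`betaLowerH_of_le_zeroHist`**, `betaUpperH_of_zeroHist_le`, **`betaAFH_iff_exists_pos_floor`**, **`isLUB_boxFloors`**,
   **`isGLB_boxCeilings`**.
§2 `le_zeroHist_of_small_histories`, `zeroHist_le_of_small_histories`, `lastWindow_of_runH`, `le_end_of_discrete031H`, **`zeroHist_window_of_pinnedRuns`**.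
§3 `zeroHist_mem_Icc`, `bddBelow_zeroHist`, `bddAbove_zeroHist`, `eventually_half_bstar_le_zeroHist`, `exists_pos_floor_of_eventual`, **`exists_pos_floor_iff`**, `iInf_zeroHist_pos_iff`,
   **`exists_zeroHist_eq_zero`**.
NOT CLAIMED: the existence, value or sign of such values for Bałaban's β; which reading of (0.31) print intends; Theorem 2; `BetaPertH`; continuum; Clay.
-/

namespace Summit.QuantumFields.BalabanUV.Beta.EriceFlowEnclosureB12AsPrintedPointwiseFadingZeroHistoryConstants

open Finset Filter Topology
open Literature.MathematicalPhysics.QuantumFieldTheory.Balaban1983to89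
open Literature.MathematicalPhysics.QuantumFieldTheory.Balaban1983to89.FlowStep (HBeta prefixOf Box mem_box box_mono RGEqH BetaLowerH BetaUpperH
  BetaAFH)
open Literature.MathematicalPhysics.QuantumFieldTheory.Balaban1983to89.T4CouplingMatching (HistLipschitz FadingMemory ScaleShiftRate)
open Literature.MathematicalPhysics.QuantumFieldTheory.Balaban1983to89.T4BetaStationary (betaInf constant_nonneg_of_scaleShiftRate)
open Summit.QuantumFields.BalabanUV.Beta.EriceFlowEnclosureB12AsPrintedPointwiseFading (rowSum_le)
open Summit.QuantumFields.BalabanUV.Beta.EriceFlowEnclosureB12AsPrintedPointwiseFadingZeroHistory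

noncomputable section

variable {β : HBeta} {γ C c θ : ℝ} {Λ : ℕ → ℕ → ℝ}

/-! ## §1 Box letters ⟺ bounds on the zero-history values; the optimal box constants -/

/-- **A BOX FLOOR IS A FLOOR ON EVERY ZERO-HISTORY VALUE**: if `b ≤ β_{k+1}` on the boxes ]0, δ]^{k+1} (`BetaLowerH b δ β`, ANY `δ > 0`) and `b⁰` are part 13's zero-history values on
]0, γ] (`hb0`), then `b ≤ b⁰_k` for every k (along the constant histories `(u,…,u)`, `u → 0⁺`). [folklore] -/
theorem le_zeroHist_of_betaLowerH (hθ1 : θ < 1) (hC : 0 ≤ C) (hγ : 0 < γ) {b0 : ℕ → ℝ}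
    (hb0 : ∀ (k : ℕ) (u : ℝ), 0 < u → u ≤ γ → |β k (fun _ : Fin (k + 1) => u) - b0 k| ≤ C * u / (1 - θ))
    {b δ : ℝ} (hδ : 0 < δ) (hlo : BetaLowerH b δ β) (k : ℕ) : b ≤ b0 k := by
  have h1θ : 0 < 1 - θ := by linarith
  refine le_of_forall_pos_le_add fun ε hε => ?_
  obtain ⟨u, hu, huγ, hsmall⟩ := exists_small_const (lt_min hγ hδ) hC hθ1 hε
  have h1 := hlo k (fun _ : Fin (k + 1) => u) (mem_box.mpr fun _ => ⟨hu, huγ.trans (min_le_right _ _)⟩)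
  have h2 := (abs_le.mp (hb0 k u hu (huγ.trans (min_le_left _ _)))).2
  have h3 : C * u / (1 - θ) ≤ 2 * C * u / (1 - θ) := div_le_div_of_nonneg_right (by nlinarith [hu.le]) h1θ.le
  linarith

/-- **A BOX CEILING IS A CEILING ON EVERY ZERO-HISTORY VALUE**: `BetaUpperH b′ δ β` (any `δ > 0`) ⟹ `b⁰_k ≤ b′` for every k. [folklore] -/
theorem zeroHist_le_of_betaUpperH (hθ1 : θ < 1) (hC : 0 ≤ C) (hγ : 0 < γ) {b0 : ℕ → ℝ}
    (hb0 : ∀ (k : ℕ) (u : ℝ), 0 < u → u ≤ γ → |β k (fun _ : Fin (k + 1) => u) - b0 k| ≤ C * u / (1 - θ))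
    {b' δ : ℝ} (hδ : 0 < δ) (hup : BetaUpperH b' δ β) (k : ℕ) : b0 k ≤ b' := by
  have h1θ : 0 < 1 - θ := by linarith
  refine le_of_forall_pos_le_add fun ε hε => ?_
  obtain ⟨u, hu, huγ, hsmall⟩ := exists_small_const (lt_min hγ hδ) hC hθ1 hε
  have h1 := hup k (fun _ : Fin (k + 1) => u) (mem_box.mpr fun _ => ⟨hu, huγ.trans (min_le_right _ _)⟩)
  have h2 := (abs_le.mp (hb0 k u hu (huγ.trans (min_le_left _ _)))).1
  have h3 : C * u / (1 - θ) ≤ 2 * C * u / (1 - θ) := div_le_div_of_nonneg_right (by nlinarith [hu.le]) h1θ.le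
  linarith

/-- **A FLOOR ON THE ZERO-HISTORY VALUES IS A BOX FLOOR ON EVERY SUB-BOX, UP TO `Cδ∕(1−θ)`**: under the moduli, `(∀k, b ≤ b⁰_k)` ⟹ `BetaLowerH (b − Cδ∕(1−θ)) δ β` for every
`0 < δ ≤ γ` (part 13's `abs_sub_zeroHist_le_box`).  With `b > 0` and `Cδ∕(1−θ) ≤ b∕2` this is the cell's AF letter at ALL scales. [folklore] -/
theorem betaLowerH_of_le_zeroHist (hL : HistLipschitz Λ γ β) (hΛ : FadingMemory C θ Λ) (hθ0 : 0 ≤ θ) (hθ1 : θ < 1) (hC : 0 ≤ C)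
    (hγ : 0 < γ) {b0 : ℕ → ℝ}
    (hb0 : ∀ (k : ℕ) (u : ℝ), 0 < u → u ≤ γ → |β k (fun _ : Fin (k + 1) => u) - b0 k| ≤ C * u / (1 - θ))
    {b : ℝ} (hfloor : ∀ k, b ≤ b0 k) {δ : ℝ} (hδ : 0 < δ) (hδγ : δ ≤ γ) :
    BetaLowerH (b - C * δ / (1 - θ)) δ β := fun k v hv => by
  have h := (abs_le.mp (abs_sub_zeroHist_le_box hL hΛ hθ0 hθ1 hC hγ hb0 hδ hδγ hv)).1
  linarith [hfloor k]

/-- The upper twin: `(∀k, b⁰_k ≤ b′)` ⟹ `BetaUpperH (b′ + Cδ∕(1−θ)) δ β` for every `0 < δ ≤ γ`. [folklore] -/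
theorem betaUpperH_of_zeroHist_le (hL : HistLipschitz Λ γ β) (hΛ : FadingMemory C θ Λ) (hθ0 : 0 ≤ θ) (hθ1 : θ < 1) (hC : 0 ≤ C)
    (hγ : 0 < γ) {b0 : ℕ → ℝ}
    (hb0 : ∀ (k : ℕ) (u : ℝ), 0 < u → u ≤ γ → |β k (fun _ : Fin (k + 1) => u) - b0 k| ≤ C * u / (1 - θ))
    {b' : ℝ} (hceil : ∀ k, b0 k ≤ b') {δ : ℝ} (hδ : 0 < δ) (hδγ : δ ≤ γ) :
    BetaUpperH (b' + C * δ / (1 - θ)) δ β := fun k v hv => by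
  have h := (abs_le.mp (abs_sub_zeroHist_le_box hL hΛ hθ0 hθ1 hC hγ hb0 hδ hδγ hv)).2
  linarith [hceil k]

/-- **THE CELL's AF LETTER IS THE POSITIVITY OF A FLOOR ON THE ONE-LOOP COEFFICIENTS**: under the moduli, `FlowStep.BetaAFH β` (∃ box with `0 < b ≤ β_{k+1}` at every scale — `FlowStep`
§5's located unprinted input) ⟺ `∃ b > 0, ∀k, b ≤ b⁰_k`.  (⟹) `le_zeroHist_of_betaLowerH`; (⟸) `betaLowerH_of_le_zeroHist` on the box `2Cδ∕(1−θ) ≤ b`. [cite: Balaban1987RG1, Thm 2 (0.31) p.259 and §1 p.264] -/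
theorem betaAFH_iff_exists_pos_floor (hL : HistLipschitz Λ γ β) (hΛ : FadingMemory C θ Λ) (hθ0 : 0 ≤ θ) (hθ1 : θ < 1) (hC : 0 ≤ C)
    (hγ : 0 < γ) {b0 : ℕ → ℝ}
    (hb0 : ∀ (k : ℕ) (u : ℝ), 0 < u → u ≤ γ → |β k (fun _ : Fin (k + 1) => u) - b0 k| ≤ C * u / (1 - θ)) :
    BetaAFH β ↔ ∃ b : ℝ, 0 < b ∧ ∀ k, b ≤ b0 k := by
  constructor
  · rintro ⟨δ, hδ, b, hb, hlo⟩
    exact ⟨b, hb, le_zeroHist_of_betaLowerH hθ1 hC hγ hb0 hδ hlo⟩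
  · rintro ⟨b, hb, hfloor⟩
    obtain ⟨δ, hδ, hδγ, hsmall⟩ := exists_small_const hγ hC hθ1 hb
    refine ⟨δ, hδ, b - C * δ / (1 - θ), ?_, betaLowerH_of_le_zeroHist hL hΛ hθ0 hθ1 hC hγ hb0 hfloor hδ hδγ⟩
    have e : C * δ / (1 - θ) = 2 * C * δ / (1 - θ) / 2 := by ring
    linarith

/-- **THE OPTIMAL BOX FLOOR IS `⨅_k b⁰_k`.**  Under the moduli, with `b⁰` bounded below: the set of admissible box floors `{b ∣ ∃ δ > 0, BetaLowerH b δ β}` has LEAST UPPER BOUND `⨅_k b⁰_k`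
(every admissible floor is `≤ b⁰_k` for all k; `⨅_k b⁰_k − ε` is admissible on the box `2Cδ∕(1−θ) ≤ ε`).  Whether the supremum itself is admissible is decided by the history term
(part 13b's boundary analysis at one scale). [folklore] -/
theorem isLUB_boxFloors (hL : HistLipschitz Λ γ β) (hΛ : FadingMemory C θ Λ) (hθ0 : 0 ≤ θ) (hθ1 : θ < 1) (hC : 0 ≤ C) (hγ : 0 < γ)
    {b0 : ℕ → ℝ} (hb0 : ∀ (k : ℕ) (u : ℝ), 0 < u → u ≤ γ → |β k (fun _ : Fin (k + 1) => u) - b0 k| ≤ C * u / (1 - θ))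
    (hbdd : BddBelow (Set.range b0)) :
    IsLUB {b : ℝ | ∃ δ : ℝ, 0 < δ ∧ BetaLowerH b δ β} (⨅ k, b0 k) := by
  have h1θ : 0 < 1 - θ := by linarith
  constructor
  · rintro b ⟨δ, hδ, hlo⟩
    exact le_ciInf fun k => le_zeroHist_of_betaLowerH hθ1 hC hγ hb0 hδ hlo k
  · intro x hx
    refine le_of_forall_pos_le_add fun ε hε => ?_
    obtain ⟨δ, hδ, hδγ, hsmall⟩ := exists_small_const hγ hC hθ1 hε
    have hmem : (⨅ k, b0 k) - ε ∈ {b : ℝ | ∃ δ : ℝ, 0 < δ ∧ BetaLowerH b δ β} := by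
      refine ⟨δ, hδ, fun k v hv => ?_⟩
      have h := betaLowerH_of_le_zeroHist hL hΛ hθ0 hθ1 hC hγ hb0 (fun k => ciInf_le hbdd k) hδ hδγ k v hv
      have h3 : C * δ / (1 - θ) ≤ 2 * C * δ / (1 - θ) := div_le_div_of_nonneg_right (by nlinarith [hδ.le]) h1θ.le
      linarith
    linarith [hx hmem]

/-- **THE OPTIMAL BOX CEILING IS `⨆_k b⁰_k`**: with `b⁰` bounded above, the admissible box ceilings `{b′ ∣ ∃ δ > 0, BetaUpperH b′ δ β}` have GREATEST LOWER BOUND `⨆_k b⁰_k`. [folklore] -/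
theorem isGLB_boxCeilings (hL : HistLipschitz Λ γ β) (hΛ : FadingMemory C θ Λ) (hθ0 : 0 ≤ θ) (hθ1 : θ < 1) (hC : 0 ≤ C) (hγ : 0 < γ)
    {b0 : ℕ → ℝ} (hb0 : ∀ (k : ℕ) (u : ℝ), 0 < u → u ≤ γ → |β k (fun _ : Fin (k + 1) => u) - b0 k| ≤ C * u / (1 - θ))
    (hbdd : BddAbove (Set.range b0)) :
    IsGLB {b' : ℝ | ∃ δ : ℝ, 0 < δ ∧ BetaUpperH b' δ β} (⨆ k, b0 k) := by
  have h1θ : 0 < 1 - θ := by linarith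
  constructor
  · rintro b' ⟨δ, hδ, hup⟩
    exact ciSup_le fun k => zeroHist_le_of_betaUpperH hθ1 hC hγ hb0 hδ hup k
  · intro x hx
    refine le_of_forall_pos_le_add fun ε hε => ?_
    obtain ⟨δ, hδ, hδγ, hsmall⟩ := exists_small_const hγ hC hθ1 hε
    have hmem : (⨆ k, b0 k) + ε ∈ {b' : ℝ | ∃ δ : ℝ, 0 < δ ∧ BetaUpperH b' δ β} := by
      refine ⟨δ, hδ, fun k v hv => ?_⟩
      have h := betaUpperH_of_zeroHist_le hL hΛ hθ0 hθ1 hC hγ hb0 (fun k => le_ciSup hbdd k) hδ hδγ k v hv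
      have h3 : C * δ / (1 - θ) ≤ 2 * C * δ / (1 - θ) := div_le_div_of_nonneg_right (by nlinarith [hδ.le]) h1θ.le
      linarith
    linarith [hx hmem]

/-! ## §2 Run-wise necessity at one scale: small histories and pinned runs bound `b⁰_k` -/

/-- **SMALL HISTORIES CARRYING A FLOOR FORCE IT ON `b⁰_k`.**  Under the moduli: if for every `ε > 0` some history `v ∈ ]0, γ]^{k+1}` with all entries `≤ ε` has `B − M·ε ≤ β_{k+1}(v)`
(`M ≥ 0` — a defect linear in the size is allowed), then `B ≤ b⁰_k` (the fading corner bound gives `|β_{k+1}(v) − b⁰_k| ≤ Cε∕(1−θ)`).  The histories need NOT be constant — run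
prefixes qualify. [folklore] -/
theorem le_zeroHist_of_small_histories (hL : HistLipschitz Λ γ β) (hΛ : FadingMemory C θ Λ) (hθ0 : 0 ≤ θ) (hθ1 : θ < 1) (hC : 0 ≤ C)
    (hγ : 0 < γ) {b0 : ℕ → ℝ}
    (hb0 : ∀ (k : ℕ) (u : ℝ), 0 < u → u ≤ γ → |β k (fun _ : Fin (k + 1) => u) - b0 k| ≤ C * u / (1 - θ))
    {k : ℕ} {B M : ℝ} (hM : 0 ≤ M)
    (h : ∀ ε : ℝ, 0 < ε → ∃ v ∈ Box γ k, (∀ i, v i ≤ ε) ∧ B - M * ε ≤ β k v) : B ≤ b0 k := by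
  have h1θ : 0 < 1 - θ := by linarith
  have hK : 0 ≤ M + C / (1 - θ) := add_nonneg hM (div_nonneg hC h1θ.le)
  refine le_of_forall_pos_le_add fun η hη => ?_
  obtain ⟨v, hv, hvε, hB⟩ := h (η / (M + C / (1 - θ) + 1)) (by positivity)
  have hclose : |β k v - b0 k| ≤ C * (η / (M + C / (1 - θ) + 1)) / (1 - θ) := by
    refine (abs_sub_zeroHist_le_sum_moduli hL hΛ hθ0 hθ1 hC hγ hb0 hv).trans ?_
    have hterm : ∀ i : Fin (k + 1), Λ k i * v i ≤ Λ k i * (η / (M + C / (1 - θ) + 1)) := fun i =>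
      mul_le_mul_of_nonneg_left (hvε i) (hΛ k i (Nat.le_of_lt_succ i.isLt)).1
    calc ∑ i : Fin (k + 1), Λ k i * v i ≤ ∑ i : Fin (k + 1), Λ k i * (η / (M + C / (1 - θ) + 1)) := Finset.sum_le_sum fun i _ => hterm i
      _ = η / (M + C / (1 - θ) + 1) * ∑ i : Fin (k + 1), Λ k i := by
          rw [Finset.mul_sum]; exact Finset.sum_congr rfl fun i _ => mul_comm _ _
      _ ≤ η / (M + C / (1 - θ) + 1) * (C / (1 - θ)) := mul_le_mul_of_nonneg_left (rowSum_le hθ0 hθ1 hC hΛ k) (by positivity)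
      _ = C * (η / (M + C / (1 - θ) + 1)) / (1 - θ) := by ring
  have h2 := (abs_le.mp hclose).2
  have hη' : (M + C / (1 - θ)) * (η / (M + C / (1 - θ) + 1)) ≤ η := by
    rw [mul_div_assoc', div_le_iff₀ (by positivity)]
    nlinarith
  have e : (M + C / (1 - θ)) * (η / (M + C / (1 - θ) + 1)) =
      M * (η / (M + C / (1 - θ) + 1)) + C * (η / (M + C / (1 - θ) + 1)) / (1 - θ) := by ring
  linarith

/-- The upper twin: small histories with `β_{k+1}(v) ≤ B′ + M·ε` for every `ε > 0` force `b⁰_k ≤ B′`. [folklore] -/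
theorem zeroHist_le_of_small_histories (hL : HistLipschitz Λ γ β) (hΛ : FadingMemory C θ Λ) (hθ0 : 0 ≤ θ) (hθ1 : θ < 1) (hC : 0 ≤ C)
    (hγ : 0 < γ) {b0 : ℕ → ℝ}
    (hb0 : ∀ (k : ℕ) (u : ℝ), 0 < u → u ≤ γ → |β k (fun _ : Fin (k + 1) => u) - b0 k| ≤ C * u / (1 - θ))
    {k : ℕ} {B' M : ℝ} (hM : 0 ≤ M)
    (h : ∀ ε : ℝ, 0 < ε → ∃ v ∈ Box γ k, (∀ i, v i ≤ ε) ∧ β k v ≤ B' + M * ε) : b0 k ≤ B' := by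
  have hneg : -B' ≤ -b0 k := by
    refine le_zeroHist_of_small_histories (β := fun k v => -β k v) (Λ := Λ) (b0 := fun k => -b0 k)
      (fun k p q hp hq => by rw [← abs_neg]; convert hL k p q hp hq using 2; ring) hΛ hθ0 hθ1 hC hγ
      (fun k u hu huγ => by rw [← abs_neg]; convert hb0 k u hu huγ using 2; ring) hM fun ε hε => ?_
    obtain ⟨v, hv, hvε, hB⟩ := h ε hε
    exact ⟨v, hv, hvε, by linarith⟩
  linarith

/-- The last window of a run: a run `r` of (0.20) of depth k+1 with the (0.31)-window `Step.Discrete031 B B′ (k+1) (r_{k+1}) r` has `B ≤ β_{k+1}(r_{≤k}) ≤ B′` ((0.31) at scale k minus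
(0.20) at scale k; part 9's `lastWindow_of_run`, here for a generic family). [cite: Balaban1987RG1, (0.20) p.256 and (0.31) p.259] -/
theorem lastWindow_of_runH {B B' : ℝ} {k : ℕ} {r : ℕ → ℝ} (hrg : RGEqH (k + 1) β r) (hD : Step.Discrete031 B B' (k + 1) (r (k + 1)) r) :
    B ≤ β k (prefixOf r k) ∧ β k (prefixOf r k) ≤ B' := by
  have e := hrg k (Nat.lt_succ_self k)
  have h := hD k (Nat.le_succ k)
  push_cast at h
  constructor <;> nlinarith [h.1, h.2, e]

/-- Along a positive run with the lower (0.31)-window at a constant `B ≥ 0`, every coupling is below the endpoint: `r_i ≤ r_K` (part 9's `le_end_of_discrete031`, generic). [cite: Balaban1987RG1, (0.31) p.259] -/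
theorem le_end_of_discrete031H {B B' : ℝ} {K : ℕ} {r : ℕ → ℝ} (hB : 0 ≤ B) (hpos : ∀ i, i ≤ K → 0 < r i)
    (hD : Step.Discrete031 B B' K (r K) r) {i : ℕ} (hi : i ≤ K) : r i ≤ r K := by
  have h := (hD i hi).1
  have hiK : (i : ℝ) ≤ K := by exact_mod_cast hi
  have hd : (0 : ℝ) ≤ (K : ℝ) - i := by linarith
  have hle : 1 / (r K) ^ 2 ≤ 1 / (r i) ^ 2 := by nlinarith [mul_nonneg hB hd]
  exact (pow_le_pow_iff_left₀ (hpos i hi).le (hpos K le_rfl).le two_ne_zero).mp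
    ((one_div_le_one_div (pow_pos (hpos K le_rfl) 2) (pow_pos (hpos i hi) 2)).mp hle)

/-- **(0.31) ON THE LATTICE `K = k+1` BOUNDS THE k-TH ONE-LOOP COEFFICIENT.**  Under the moduli: if for every endpoint `g ∈ ]0, g₁]` some run `r` of (0.20) of depth k+1 inside ]0, γ] ends
at `r_{k+1} = g` with the (0.31)-window `[B, B′]` (`B ≥ 0`), then **`B ≤ b⁰_k ≤ B′`** (the run prefix is a small history — every `r_i ≤ g` — carrying `B ≤ β_{k+1}(r_{≤k}) ≤ B′`; §2 above
with `M = 0`).  The (0.31) constants of ANY pinned run family near zero, read scale by scale, enclose the intrinsic one-loop coefficients. [cite: Balaban1987RG1, Thm 2 (0.31) p.259 with (0.20) p.256 and (2.12) p.268] -/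
theorem zeroHist_window_of_pinnedRuns (hL : HistLipschitz Λ γ β) (hΛ : FadingMemory C θ Λ) (hθ0 : 0 ≤ θ) (hθ1 : θ < 1) (hC : 0 ≤ C)
    (hγ : 0 < γ) {b0 : ℕ → ℝ}
    (hb0 : ∀ (k : ℕ) (u : ℝ), 0 < u → u ≤ γ → |β k (fun _ : Fin (k + 1) => u) - b0 k| ≤ C * u / (1 - θ))
    {k : ℕ} {B B' g₁ : ℝ} (hB : 0 ≤ B) (hg₁ : 0 < g₁)
    (h : ∀ g : ℝ, 0 < g → g ≤ g₁ → ∃ r : ℕ → ℝ, RGEqH (k + 1) β r ∧ Step.InInterval γ (k + 1) r ∧ r (k + 1) = g ∧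
      Step.Discrete031 B B' (k + 1) g r) : B ≤ b0 k ∧ b0 k ≤ B' := by
  have key : ∀ ε : ℝ, 0 < ε → ∃ v ∈ Box γ k, (∀ i, v i ≤ ε) ∧ B ≤ β k v ∧ β k v ≤ B' := by
    intro ε hε
    obtain ⟨r, hrg, hI, hend, hD⟩ := h (min g₁ ε) (lt_min hg₁ hε) (min_le_left _ _)
    rw [← hend] at hD
    obtain ⟨hlo, hhi⟩ := lastWindow_of_runH hrg hD
    refine ⟨prefixOf r k, mem_box.mpr fun i => hI i i.isLt.le, fun i => ?_, hlo, hhi⟩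
    have hri := le_end_of_discrete031H hB (fun i hi => (hI i hi).1) hD (i := (i : ℕ)) i.isLt.le
    rw [hend] at hri
    exact hri.trans (min_le_right _ _)
  constructor
  · exact le_zeroHist_of_small_histories hL hΛ hθ0 hθ1 hC hγ hb0 le_rfl fun ε hε => by
      obtain ⟨v, hv, hvε, hlo, -⟩ := key ε hε
      exact ⟨v, hv, hvε, by linarith⟩
  · exact zeroHist_le_of_small_histories hL hΛ hθ0 hθ1 hC hγ hb0 le_rfl fun ε hε => by
      obtain ⟨v, hv, hvε, -, hhi⟩ := key ε hε
      exact ⟨v, hv, hvε, by linarith⟩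

/-! ## §3 With NE4: boundedness, the eventual half-floor, «positive floor ⟺ sign of the limit + the intrinsic CAP list», the face -/

/-- Under NE4 the zero-history values lie within `c∕(1−θ)` of `b⋆` (part 13's rate `cθ^k∕(1−θ)` with `θ^k ≤ 1`). [folklore] -/
theorem zeroHist_mem_Icc (hS : ScaleShiftRate c θ γ β) (hθ0 : 0 ≤ θ) (hθ1 : θ < 1) (hC : 0 ≤ C) (hγ : 0 < γ) {b0 : ℕ → ℝ}
    (hb0 : ∀ (k : ℕ) (u : ℝ), 0 < u → u ≤ γ → |β k (fun _ : Fin (k + 1) => u) - b0 k| ≤ C * u / (1 - θ)) {bstar : ℝ}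
    (hb : ∀ u : ℝ, 0 < u → u ≤ γ → |betaInf β (fun _ : ℕ => u) - bstar| ≤ C * u / (1 - θ)) (k : ℕ) :
    bstar - c / (1 - θ) ≤ b0 k ∧ b0 k ≤ bstar + c / (1 - θ) := by
  have h1θ : 0 < 1 - θ := by linarith
  have hc : 0 ≤ c := constant_nonneg_of_scaleShiftRate hS hγ
  have h := abs_le.mp (abs_zeroHist_sub_bstar_le hS hθ1 hC hγ hb0 hb k)
  have hθk : θ ^ k ≤ 1 := pow_le_one₀ hθ0 hθ1.le
  have hr : c * θ ^ k / (1 - θ) ≤ c / (1 - θ) := div_le_div_of_nonneg_right (by nlinarith) h1θ.le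
  exact ⟨by linarith [h.1], by linarith [h.2]⟩

/-- Under NE4 the zero-history values are bounded below (by `b⋆ − c∕(1−θ)`). [folklore] -/
theorem bddBelow_zeroHist (hS : ScaleShiftRate c θ γ β) (hθ0 : 0 ≤ θ) (hθ1 : θ < 1) (hC : 0 ≤ C) (hγ : 0 < γ) {b0 : ℕ → ℝ}
    (hb0 : ∀ (k : ℕ) (u : ℝ), 0 < u → u ≤ γ → |β k (fun _ : Fin (k + 1) => u) - b0 k| ≤ C * u / (1 - θ)) {bstar : ℝ}
    (hb : ∀ u : ℝ, 0 < u → u ≤ γ → |betaInf β (fun _ : ℕ => u) - bstar| ≤ C * u / (1 - θ)) : BddBelow (Set.range b0) :=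
  ⟨bstar - c / (1 - θ), by rintro _ ⟨k, rfl⟩; exact (zeroHist_mem_Icc hS hθ0 hθ1 hC hγ hb0 hb k).1⟩

/-- Under NE4 the zero-history values are bounded above (by `b⋆ + c∕(1−θ)`). [folklore] -/
theorem bddAbove_zeroHist (hS : ScaleShiftRate c θ γ β) (hθ0 : 0 ≤ θ) (hθ1 : θ < 1) (hC : 0 ≤ C) (hγ : 0 < γ) {b0 : ℕ → ℝ}
    (hb0 : ∀ (k : ℕ) (u : ℝ), 0 < u → u ≤ γ → |β k (fun _ : Fin (k + 1) => u) - b0 k| ≤ C * u / (1 - θ)) {bstar : ℝ}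
    (hb : ∀ u : ℝ, 0 < u → u ≤ γ → |betaInf β (fun _ : ℕ => u) - bstar| ≤ C * u / (1 - θ)) : BddAbove (Set.range b0) :=
  ⟨bstar + c / (1 - θ), by rintro _ ⟨k, rfl⟩; exact (zeroHist_mem_Icc hS hθ0 hθ1 hC hγ hb0 hb k).2⟩

/-- **THE EVENTUAL HALF-FLOOR**: under NE4 with `0 < b⋆` there is a threshold `k₁` (any `k₁` with `cθ^{k₁}∕(1−θ) ≤ b⋆∕2`) beyond which `b⋆∕2 ≤ b⁰_k` (part 13d's last clause, stated for a
GIVEN `b⁰`; the indices `k < k₁` are the INTRINSIC CAP LIST). [folklore] -/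
theorem eventually_half_bstar_le_zeroHist (hS : ScaleShiftRate c θ γ β) (hθ0 : 0 ≤ θ) (hθ1 : θ < 1) (hC : 0 ≤ C) (hγ : 0 < γ)
    {b0 : ℕ → ℝ} (hb0 : ∀ (k : ℕ) (u : ℝ), 0 < u → u ≤ γ → |β k (fun _ : Fin (k + 1) => u) - b0 k| ≤ C * u / (1 - θ))
    {bstar : ℝ} (hb : ∀ u : ℝ, 0 < u → u ≤ γ → |betaInf β (fun _ : ℕ => u) - bstar| ≤ C * u / (1 - θ)) (hpos : 0 < bstar) :
    ∃ k₁ : ℕ, c * θ ^ k₁ / (1 - θ) ≤ bstar / 2 ∧ ∀ k, k₁ ≤ k → bstar / 2 ≤ b0 k := by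
  have h1θ : 0 < 1 - θ := by linarith
  have hc : 0 ≤ c := constant_nonneg_of_scaleShiftRate hS hγ
  have hrate := abs_zeroHist_sub_bstar_le hS hθ1 hC hγ hb0 hb
  obtain ⟨k₁, hk₁⟩ : ∃ k₁ : ℕ, c * θ ^ k₁ / (1 - θ) ≤ bstar / 2 := by
    rcases eq_or_lt_of_le hc with h0 | hcpos
    · exact ⟨0, by rw [← h0]; simp; positivity⟩
    · obtain ⟨k₁, hk⟩ := exists_pow_lt_of_lt_one (show 0 < bstar / 2 * (1 - θ) / c by positivity) hθ1
      refine ⟨k₁, ?_⟩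
      rw [div_le_iff₀ h1θ]
      have := (lt_div_iff₀ hcpos).mp hk
      linarith
  refine ⟨k₁, hk₁, fun k hk => ?_⟩
  have h := (abs_le.mp (hrate k)).1
  have hθk : c * θ ^ k / (1 - θ) ≤ c * θ ^ k₁ / (1 - θ) :=
    div_le_div_of_nonneg_right (mul_le_mul_of_nonneg_left (pow_le_pow_of_le_one hθ0 hθ1.le hk) hc) h1θ.le
  linarith

/-- Finite bookkeeping: a positive floor from scale `n` on, plus positivity of the finitely many earlier values, is a positive floor at ALL scales (induction on `n`, taking minima). [folklore] -/
theorem exists_pos_floor_of_eventual {b0 : ℕ → ℝ} :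
    ∀ (n : ℕ) (b' : ℝ), 0 < b' → (∀ k, n ≤ k → b' ≤ b0 k) → (∀ k, k < n → 0 < b0 k) → ∃ b : ℝ, 0 < b ∧ ∀ k, b ≤ b0 k := by
  intro n
  induction n with
  | zero => exact fun b' hb' hge _ => ⟨b', hb', fun k => hge k (Nat.zero_le k)⟩
  | succ n ih =>
    intro b' hb' hge hpos
    have hn : 0 < b0 n := hpos n (Nat.lt_succ_self n)
    refine ih (min b' (b0 n)) (lt_min hb' hn) (fun k hk => ?_) fun k hk => hpos k (Nat.lt_succ_of_lt hk)
    rcases Nat.eq_or_lt_of_le hk with h | h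
    · rw [← h]; exact min_le_right _ _
    · exact (min_le_left _ _).trans (hge k (Nat.succ_le_of_lt h))

/-- **A POSITIVE FLOOR ⟺ THE SIGN OF THE LIMIT + THE INTRINSIC CAP LIST.**  Under NE4 (+ part 11's `b⋆`): `(∃ b > 0, ∀k, b ≤ b⁰_k) ⟺ (0 < b⋆ ∧ ∀k, 0 < b⁰_k)`.  (⟹) `b⁰_k → b⋆`, so
`b⋆ ≥ b > 0`; (⟸) the eventual half-floor `b⋆∕2` beyond `k₁` and the finitely many positive early values.  With §1 this prices the AF letter `BetaAFH β` in the β-flow team's numbers: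
the ONE sign bit of the limit (what the typed Theorem 2 delivers, part 11d) AND the signs of the early one-loop coefficients (the cell's CAP list, here intrinsic). [cite: Balaban1987RG1, Thm 2 (0.31) p.259 with (2.12) p.268] -/
theorem exists_pos_floor_iff (hS : ScaleShiftRate c θ γ β) (hθ0 : 0 ≤ θ) (hθ1 : θ < 1) (hC : 0 ≤ C) (hγ : 0 < γ) {b0 : ℕ → ℝ}
    (hb0 : ∀ (k : ℕ) (u : ℝ), 0 < u → u ≤ γ → |β k (fun _ : Fin (k + 1) => u) - b0 k| ≤ C * u / (1 - θ)) {bstar : ℝ}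
    (hb : ∀ u : ℝ, 0 < u → u ≤ γ → |betaInf β (fun _ : ℕ => u) - bstar| ≤ C * u / (1 - θ)) :
    (∃ b : ℝ, 0 < b ∧ ∀ k, b ≤ b0 k) ↔ 0 < bstar ∧ ∀ k, 0 < b0 k := by
  constructor
  · rintro ⟨b, hbpos, hfloor⟩
    exact ⟨hbpos.trans_le (ge_of_tendsto' (tendsto_zeroHist_bstar hS hθ0 hθ1 hC hγ hb0 hb) hfloor),
      fun k => hbpos.trans_le (hfloor k)⟩
  · rintro ⟨hpos, hall⟩
    obtain ⟨k₁, -, hk₁⟩ := eventually_half_bstar_le_zeroHist hS hθ0 hθ1 hC hγ hb0 hb hpos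
    exact exists_pos_floor_of_eventual k₁ (bstar / 2) (by positivity) hk₁ fun k _ => hall k

/-- The same bit as the sign of the infimum: with `b⁰` bounded below, `0 < ⨅_k b⁰_k ⟺ ∃ b > 0, ∀k, b ≤ b⁰_k`. [folklore] -/
theorem iInf_zeroHist_pos_iff {b0 : ℕ → ℝ} (hbdd : BddBelow (Set.range b0)) :
    0 < ⨅ k, b0 k ↔ ∃ b : ℝ, 0 < b ∧ ∀ k, b ≤ b0 k :=
  ⟨fun h => ⟨⨅ k, b0 k, h, fun k => ciInf_le hbdd k⟩, fun ⟨_, hbpos, hfloor⟩ => hbpos.trans_le (le_ciInf hfloor)⟩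

/-- **THE FACE.**  Under NE4: if every zero-history value is `≥ 0`, the limit is `> 0`, and yet NO positive floor exists, then SOME `b⁰_k` VANISHES — a one-loop coefficient equal to zero
at a finite scale.  (Part 14b: this is exactly where the typed and the uniform readings of (0.31) part ways; part 8a's ramp family sits here with `b⁰ = (1, 0, 1, 1, …)`.) [folklore] -/
theorem exists_zeroHist_eq_zero (hS : ScaleShiftRate c θ γ β) (hθ0 : 0 ≤ θ) (hθ1 : θ < 1) (hC : 0 ≤ C) (hγ : 0 < γ) {b0 : ℕ → ℝ}
    (hb0 : ∀ (k : ℕ) (u : ℝ), 0 < u → u ≤ γ → |β k (fun _ : Fin (k + 1) => u) - b0 k| ≤ C * u / (1 - θ)) {bstar : ℝ}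
    (hb : ∀ u : ℝ, 0 < u → u ≤ γ → |betaInf β (fun _ : ℕ => u) - bstar| ≤ C * u / (1 - θ)) (hpos : 0 < bstar)
    (hnonneg : ∀ k, 0 ≤ b0 k) (hno : ¬ ∃ b : ℝ, 0 < b ∧ ∀ k, b ≤ b0 k) : ∃ k, b0 k = 0 := by
  by_contra hne
  exact hno ((exists_pos_floor_iff hS hθ0 hθ1 hC hγ hb0 hb).mpr ⟨hpos, fun k => lt_of_le_of_ne (hnonneg k) fun h => hne ⟨k, h.symm⟩⟩)

end

end Summit.QuantumFields.BalabanUV.Beta.EriceFlowEnclosureB12AsPrintedPointwiseFadingZeroHistoryConstants
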